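import Summits.QuantumFields.BalabanUV.Beta.FP.NestedStepLawTorusTransportedGraded
import Summits.QuantumFields.BalabanUV.Beta.FP.TorusSymGaugeCovariance
import Summits.QuantumFields.BalabanUV.Beta.FP.NestedFPSplit

/-!
# `BalabanUV.Beta.FP.NestedStepLawTorusTransportedGradedSymULow` — THE (III′) TORUS CALL (β-a) WITH THE SMALL-COMB DEAD ROWS `s1 s2` REPLACED BY THE FINE
# BLOCK's FADDEEV–POPOV 2-JET LETTER `uLow` (leaf-06 g21 `NestedFPSplit`, OFFER O-d1leaf06g21-1 l.44553) — v2 chain bottom; otherwise IDENTICAL to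
# `NestedStepLawTorusTransportedGradedSym` (p332010)

DIFFERENCE TO (β-a).  The `_of_uni` door's nested Faddeev–Popov letter `uT` is fed by `NestedFPSplit.secondVar_nestedFP_eq_zero_of_t_uLow` (c0 c1 c2 + the
slice letters `hup hlow` from `torus_uni₂ ∕ torus_uni₁` at `ctrOff` + `t1 t2` + `uLow`) instead of `NestedStepLawTransported.secondVar_nestedFP_eq_zero`
(`s1 s2 t1 t2`).  `uLow : secondVar (τ₁·[D₂|D₁].toCols₂) (τ₁·W₁.toCols₂) (τ₁·W₂.toCols₂) = 0` is discharged WITHOUT any hypothesis on the direction `h` by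
leaf-06's `NestedFPSplit.torus_uLow_exp` once `W₁ W₂` take their exponential closed forms (the (β-b′) layer), whereas `s1 s2` need `h` dead on the small comb.
The rest of this docstring is (β-a)'s, verbatim.

# `BalabanUV.Beta.FP.NestedStepLawTorusTransportedGradedSym` — road «FP» for binder row D1, ROUTE T, the dictionary's (J-a) «THE DOOR AT THE LITERAL OF RECORD
# (chart (III′))», item (β-a): **THE OWNER's GRADED TORUS CALL #12 RE-INSTANTIATED AT THE SYM TABLES** — the shifted spread `𝕄_j = bhKStepSh d Lc (Dsh Lc) j`
# in the `H₀ ∕ Q₁₀ ∕ Q₂₀` slots, every comb at the CENTRED root `ρ_c`; `c0 d0 hPW hTW b*` discharged inside ((α-1c) + chart-free letters), the (γ-sym)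
# sockets `h1 h2` and `hH₀t` DISPLAYED; the rows `k1 k2 q1 q2 j1 j2 uC uP′ s* t* hH₁t hH₂t a0 a1 a2 c1 c2 d1 d2` displayed as in #12 (their sym suppliers:
# leaf-02 (α-1b) `torus_c1_symVhSAt_weighted ∕ torus_d1_symVhSAt_weighted ∕ torus_q1_sym_letter`, leaf-06 `torus_j1`, … — consumed by (β-b) `…RowsGradedLevelZeroSym`)

WHAT.  The statement of `NestedStepLawTorusTransportedGraded.secondVar_oneShot_nestedStepLaw_torus_transported_graded` with `bhKStepAt d (toSite r∕r′) Lc ↦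
bhKStepSh d Lc (Dsh Lc)`, `toSite r, toSite r′ ↦ ctr (d+1) Lc`, `hr hr′` dropped, `hH₀ hfμ′ hcoarse′` dropped (they fed only `torus_h1 ∕ torus_h2_record ∕ torus_H₀_transpose`, now displayed — so `H₀` is a FREE symmetric form block here), `h1 h2 hH₀t` added; proof = the OWNER's, with `torus_cov₀'∕₁∕₂ ↦ torus_sym_cov₀'∕₁∕₂`,
`hr ↦ ctrOff_mem_box`, `torus_h1 ∕ torus_h2_record ∕ torus_H₀_transpose ↦` the displayed sockets; one application of the generic graded law
`NestedStepLawTransportedExpGraded.secondVar_oneShot_nestedStepLaw_expTransported_graded_of_uni` BY NAME.  [folklore] composition BY NAME; no `def`, no `def … : Prop`,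
nothing cited, 0 sorry.  Nothing of the dictionary ∕ Bałaban's asserted: whether these slots ARE the literal's is an2's JA-TABLE.

HONEST DEPENDENCY (page 1, mandatory): continuum YM on T⁴ ⇐ BetaPertH ∧ nine spine estimates (0/9 proved); BetaPertH ⇐ (D1) ∧ (D4) ∧ CAP+tail;
G-an2-4 gates asym, D1 and NE2/3/4.  HONEST FRAMING (cell contract, verbatim): «discharging `BetaPertH` makes Bałaban's UV stability UNCONDITIONAL —
a real constructive-QFT result; it is NOT the continuum limit and NOT the Clay problem.»  ABSOLUTE RULE (cell charter, verbatim): «No internally-minted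
statement may enter as a cited fact. Every hypothesis is either kernel-proved in this package or a verbatim quotation of a PUBLISHED theorem with page
reference. The manuscript(s) under audit are NOT citable for their own disputed steps — they are the thing under adjudication; programme-internal
(2001/route/tribunal) claims are never citable.»  0 estimates; 0∕4 row-D1 binders; NOT (T-ID), NOT (J-a) complete, NOT SDF, NOT D1, NOT BetaPertH, NOT
continuum, NOT Clay.  D1 formalisation swarm LEAF PROVER 02 (b2b-balaban-beta-d1-formalise-leaf-02 gen 21), 2026-08-22; the OWNER's #12 untouched.
-/

noncomputable section

open scoped BigOperators Matrix

namespace Summit.QuantumFields.BalabanUV.Beta.FP.NestedStepLawTorusTransportedGradedSymULow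

open Matrix Finset
open Literature.Probability.LatticeModels (Torus.proj)
open Literature.MathematicalPhysics.QuantumFieldTheory.Balaban1983to89
open Literature.MathematicalPhysics.QuantumFieldTheory.Balaban1983to89.Beta
open Literature.MathematicalPhysics.QuantumFieldTheory.Balaban1983to89.Beta.Composition (kkt)
open Literature.MathematicalPhysics.QuantumFieldTheory.Balaban1983to89.Beta.CompositionSingular (effForm flucCov minOp minOpL)
open B5Prop11Plancherel (fine)
open B6Lemma24Torus (pbox mem_pbox)
open AffineAveraging (Site box toSite)
open OneStepResolventKernel (Fib)
open Summit.QuantumFields.BalabanUV.Beta.BorderedHessian (bhKStepAt stepScale)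
open Summit.QuantumFields.BalabanUV.Beta.D1BFx.LogDetSecondVariation (secondVar)
open Summit.QuantumFields.BalabanUV.Beta.FP.KernelPeriodisationFib (Idx perF)
open Summit.QuantumFields.BalabanUV.Beta.FP.TorusGaugeCovariance (tgrad)
open Summit.QuantumFields.BalabanUV.Beta.FP.TorusGaugeCovarianceCoarse (coarsePt tgradBlock coarsePt_coe)
open Summit.QuantumFields.BalabanUV.Beta.FP.TorusCombRows (Res combRowsT)
open Summit.QuantumFields.BalabanUV.Beta.FP.TorusCombNestedBasis (resBigEquiv)
open Summit.QuantumFields.BalabanUV.Beta.FP.NestedStepLawOneShotLetters (det_ne_zero_of_abs_det det_nestedSlice_mul_gauge_ne_zero)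
open Summit.QuantumFields.BalabanUV.Beta.FP.CompositeWardLetters (compWard_b0 compWard_b1 compWard_b2)
open Summit.QuantumFields.BalabanUV.Beta.FP.NestedStepLawTorusInstance (torus_h1 torus_cov₁ torus_cov₂ torus_uni₁ torus_uni₂ torus_uni₂_ne_zero torus_uniP
  coarseSlot_injective coarseSlot_range)
open Summit.QuantumFields.BalabanUV.Beta.FP.NestedStepLawTorusInstanceDelta (torus_cov₀')
open Summit.QuantumFields.BalabanUV.Beta.FP.RelInvPeriodisedEffFormCoarse (torus_h2_record)
open Summit.QuantumFields.BalabanUV.Beta.FP.NestedStepLawTransportedExpGraded (secondVar_oneShot_nestedStepLaw_expTransported_graded_of_uni)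
open Summit.QuantumFields.BalabanUV.Beta.FP.NestedFPSplit (secondVar_nestedFP_eq_zero_of_t_uLow)
open Summit.QuantumFields.BalabanUV.Beta.FP.PeriodisedWardOrderZero (torus_H₀_transpose)
open Summit.QuantumFields.BalabanUV.Beta.FP.CoarseJetUnitGraded (torus_coarse_secondVar_of_hId_graded)
open BalabanStepJetsSucc (wVH)
open Summit.QuantumFields.BalabanUV.Beta.GAN24.FineReadoutCauchyFrame (toSite_mem_range)


open AveragingContoursRooted (ctr ctrOff ctrOff_mem_box)
open Summit.QuantumFields.BalabanUV.Beta.DshAn1 (Dsh)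
open Summit.QuantumFields.BalabanUV.Beta.SymShiftedSpread (bhKStepSh)
open Summit.QuantumFields.BalabanUV.Beta.FP.TorusSymGaugeCovariance (torus_sym_cov₁ torus_sym_cov₂ torus_sym_cov₀')

variable {d : ℕ}

section Transported

variable (M' : Fin (d + 1) → ℕ) [∀ μ, NeZero (M' μ)] {Lc : ℕ} [NeZero Lc]

set_option synthInstance.maxSize 1024 in
/-- [folklore] **THE (III′) TORUS CALL — the OWNER's graded torus call `NestedStepLawTorusTransportedGraded` (#12, p326039) RE-INSTANTIATED AT THE SYM TABLES** (an2's (J-a), item (β-a)): `H₀ ∕ Q₁₀ ∕ Q₂₀ := perF (bhKStepSh d Lc (Dsh Lc) j ∕ (j+1))` on the same slots, every comb (`τ₁ τ₂ P D₁ D₂ D̄`) at the CENTRED root `ρ_c = ctr (d+1) Lc` (the rooted shapes at `r = r′ = ctrOff`); DISCHARGED inside exactly as #12: `c0 ∕ d0` (leaf-02 (α-1c) `torus_sym_cov₁ ∕ _cov₂ ∕ _cov₀'`), `hPW hTW` (`torus_uniP ∕ torus_uni₁ ∕ _uni₂` at `ctrOff`, chart-free), `b0 b1 b2` (`compWard_b*`);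 DISPLAYED in addition to #12's letters: the (γ-sym) sockets `h1 h2` (leaf-05 g29 INTENT 30) and `hH₀t` (the level-0 instance discharges it by `torus_H₀_transpose` after `bhKStepSh_Dsh_zero_inl_inl`).  ORIGINAL DOCSTRING OF #12 (OWNER d1-p3 g19), for the unchanged letters: **THE TORUS CALL, TRANSPORT FIRST (T-β), δ-CONSTRAINED COMPOSITE, GRADED (COLOUR-STRIPPED) JETS — ZERO FADDEEV–POPOV DEFECT.**  The graded twin of
`NestedStepLawTorusTransported.secondVar_oneShot_nestedStepLaw_torus_transported` (p320614): the SAME torus objects by defining equations and the SAME nine binders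
discharged (`h1 h2 hPW hTW b0 b1 b2` from `torus_h1 torus_h2_record torus_uniP torus_uni₁∕₂ torus_cov₀'∕₁∕₂ compWard_b*`), plus `H₀ᵀ = H₀` discharged by leaf-02's
`torus_H₀_transpose`; displayed: the GRADED conjugated words `k1 : −(XᵀH₀) + H₁ + H₀X = H′₁` (for the DIAGONAL torus generator `X = −c•E_λ`, `Xᵀ = X`, this is the
commutator word `H′₁ = H₁ + (H₀X − XH₀)` of `PeriodisedFormIndexWard(Doubled)`) and `k2` (the four words led by `Xᵀ` negative), `q1 q2 j1 j2 uC` ONE-SIDED as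
p320614, the one-shot chart's (UNI)-jet letter `uP'` (dead big-comb rows, or `TorusOneShotFPExponential.torus_uP_exp`) and the nested chart's dead rows `s1 s2 t1 t2`,
the parities `H₁ᵀ = −H₁`, `H₂ᵀ = H₂` of the displayed form jets, the door's GRADED one-sided Ward rows `a0 a1 a2` (NO transposed rows `a*t`), leaf-02's covariance
rows `c1 c2 d1 d2`.  CONCLUSION: one-shot literal (odd bordered jet (−)-PLACED) `=` fine one-step sliced (odd jet (−)-placed) `+` coarse sliced (graded words,
`Bᵀ ↦ −Bᵀ`), with NO defect. -/
theorem secondVar_oneShot_nestedStepLaw_torus_transported_graded_sym_uLow (hM' : ∀ i, Lc ∣ M' i) (j : ℕ)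
    {κ : Type*} [Fintype κ] [DecidableEq κ] (pμ' : κ → ↥(pbox M')) (mμ' : κ → Fin (d + 1))
    -- the torus objects of record, by defining equations
    {H₀ : Matrix (↥(pbox (fine Lc M')) × Fin (d + 1)) (↥(pbox (fine Lc M')) × Fin (d + 1)) ℝ}
    {Q₁₀ : Matrix (↥(pbox M') × Fin (d + 1)) (↥(pbox (fine Lc M')) × Fin (d + 1)) ℝ}
    {τ₁ : Matrix (Res (ctr (d + 1) Lc) Lc (fine Lc M')) (↥(pbox (fine Lc M')) × Fin (d + 1)) ℝ}
    {τ₂ : Matrix (Res (ctr (d + 1) Lc) Lc M') (↥(pbox M') × Fin (d + 1)) ℝ}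
    {D₁ : Matrix (↥(pbox (fine Lc M')) × Fin (d + 1)) (Res (ctr (d + 1) Lc) Lc (fine Lc M')) ℝ}
    {D₂ : Matrix (↥(pbox (fine Lc M')) × Fin (d + 1)) (Res (ctr (d + 1) Lc) Lc M') ℝ}
    {Dbar : Matrix (↥(pbox M') × Fin (d + 1)) (Res (ctr (d + 1) Lc) Lc M') ℝ}
    {P : Matrix (Res (ctr (d + 1) Lc) Lc M' ⊕ Res (ctr (d + 1) Lc) Lc (fine Lc M')) (↥(pbox (fine Lc M')) × Fin (d + 1)) ℝ}
    -- `H₀` (the form block) is FREE here: the level-`j` instance pins it to the ff block of `𝕄_j` and discharges `hH₀t` ((β-b))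
    (hQ₁₀ : Q₁₀ = (perF (fine Lc M') (bhKStepSh d Lc (Dsh Lc) j)).submatrix
        (fun a : ↥(pbox M') × Fin (d + 1) => ((coarsePt M' Lc a.1, Sum.inr a.2) : Idx (fine Lc M') (Fib d)))
        (fun b : ↥(pbox (fine Lc M')) × Fin (d + 1) => ((b.1, Sum.inl b.2) : Idx (fine Lc M') (Fib d))))
    (hτ₁ : τ₁ = (combRowsT (ctr (d + 1) Lc) Lc (fine Lc M')).submatrix id
        (fun b : ↥(pbox (fine Lc M')) × Fin (d + 1) => ((b.1, Sum.inl b.2) : Idx (fine Lc M') (Fib d))))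
    (hτ₂ : τ₂ = (combRowsT (ctr (d + 1) Lc) Lc M').submatrix id (fun b : ↥(pbox M') × Fin (d + 1) => ((b.1, Sum.inl b.2) : Idx M' (Fib d))))
    (hD₁ : D₁ = (tgrad (fine Lc M')).submatrix (fun b : ↥(pbox (fine Lc M')) × Fin (d + 1) => ((b.1, Sum.inl b.2) : Idx (fine Lc M') (Fib d)))
        (Subtype.val : Res (ctr (d + 1) Lc) Lc (fine Lc M') → ↥(pbox (fine Lc M'))))
    (hD₂ : D₂ = (tgradBlock M' Lc).submatrix (fun b : ↥(pbox (fine Lc M')) × Fin (d + 1) => ((b.1, Sum.inl b.2) : Idx (fine Lc M') (Fib d)))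
        (Subtype.val : Res (ctr (d + 1) Lc) Lc M' → ↥(pbox M')))
    (hDbar : Dbar = Matrix.of fun (a : ↥(pbox M') × Fin (d + 1)) (t : Res (ctr (d + 1) Lc) Lc M') =>
        stepScale d Lc j * (((box (d + 1) Lc).card : ℝ) * tgrad M' (a.1, Sum.inl a.2) t.1))
    (hP : P = (combRowsT ((Lc : ℤ) • ctr (d + 1) Lc + ctr (d + 1) Lc) (Lc * Lc) (fine Lc M')).submatrix
        (resBigEquiv Lc Lc (ctr (d + 1) Lc) (ctr (d + 1) Lc) M' (Nat.pos_of_ne_zero (NeZero.ne Lc)) (toSite_mem_range (ctrOff_mem_box (Nat.one_le_iff_ne_zero.mpr (NeZero.ne Lc))))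
          (Nat.pos_of_ne_zero (NeZero.ne Lc)) (toSite_mem_range (ctrOff_mem_box (Nat.one_le_iff_ne_zero.mpr (NeZero.ne Lc))))).symm
        (fun b : ↥(pbox (fine Lc M')) × Fin (d + 1) => ((b.1, Sum.inl b.2) : Idx (fine Lc M') (Fib d))))
    -- the displayed jets: form, averaging (both levels), block covariance, generators (fine and coarse), Ward witnesses
    (H₁ H₂ : Matrix (↥(pbox (fine Lc M')) × Fin (d + 1)) (↥(pbox (fine Lc M')) × Fin (d + 1)) ℝ)
    {Q₂₀ : Matrix κ (↥(pbox M') × Fin (d + 1)) ℝ}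
    (hQ₂₀ : Q₂₀ = (perF M' (bhKStepSh d Lc (Dsh Lc) (j + 1))).submatrix (fun a : κ => ((pμ' a, Sum.inr (mμ' a)) : Idx M' (Fib d)))
        (fun b : ↥(pbox M') × Fin (d + 1) => ((b.1, Sum.inl b.2) : Idx M' (Fib d))))
    (Q₁₁ Q₁₂ : Matrix (↥(pbox M') × Fin (d + 1)) (↥(pbox (fine Lc M')) × Fin (d + 1)) ℝ) (Q₂₁ Q₂₂ : Matrix κ (↥(pbox M') × Fin (d + 1)) ℝ)
    (W₁ W₂ : Matrix (↥(pbox (fine Lc M')) × Fin (d + 1)) (Res (ctr (d + 1) Lc) Lc M' ⊕ Res (ctr (d + 1) Lc) Lc (fine Lc M')) ℝ)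
    (Db₁ Db₂ : Matrix (↥(pbox M') × Fin (d + 1)) (Res (ctr (d + 1) Lc) Lc M') ℝ)
    (Y₀ Y₁ Y₂ : Matrix κ (Res (ctr (d + 1) Lc) Lc M' ⊕ Res (ctr (d + 1) Lc) Lc (fine Lc M')) ℝ)
    -- the chart transport (exponential currency): generators `X` (fields), `X̄` (composite multipliers); the one-shot chart's generator jets `W♯₁ W♯₂`;
    -- the parameter-transport jets `C₁ C₂`
    (X : Matrix (↥(pbox (fine Lc M')) × Fin (d + 1)) (↥(pbox (fine Lc M')) × Fin (d + 1)) ℝ) (Xbar : Matrix κ κ ℝ)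
    (W'₁ W'₂ : Matrix (↥(pbox (fine Lc M')) × Fin (d + 1)) (Res (ctr (d + 1) Lc) Lc M' ⊕ Res (ctr (d + 1) Lc) Lc (fine Lc M')) ℝ)
    (C₁ C₂ : Matrix (Res (ctr (d + 1) Lc) Lc M' ⊕ Res (ctr (d + 1) Lc) Lc (fine Lc M')) (Res (ctr (d + 1) Lc) Lc M' ⊕ Res (ctr (d + 1) Lc) Lc (fine Lc M')) ℝ)
    {𝔔₀ 𝔔₁ 𝔔₂ : Matrix κ (↥(pbox (fine Lc M')) × Fin (d + 1)) ℝ}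
    (h𝔔₀ : Q₂₀ * Q₁₀ = 𝔔₀) (h𝔔₁ : Q₂₁ * Q₁₀ + Q₂₀ * Q₁₁ = 𝔔₁) (h𝔔₂ : Q₂₂ * Q₁₀ + Q₂₁ * Q₁₁ + (Q₂₁ * Q₁₁ + Q₂₀ * Q₁₂) = 𝔔₂)
    -- (T-β-1) GRADED: the ONE-SHOT literal's composite jets are the graded `X`-conjugated words of the nested-chart jets (`𝔎 = H`: δ-constrained), NAMED
    {H'₁ H'₂ : Matrix (↥(pbox (fine Lc M')) × Fin (d + 1)) (↥(pbox (fine Lc M')) × Fin (d + 1)) ℝ}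
    {𝔔'₁ 𝔔'₂ : Matrix κ (↥(pbox (fine Lc M')) × Fin (d + 1)) ℝ}
    (k1 : -(Xᵀ * H₀) + H₁ + H₀ * X = H'₁)
    (k2 : (X * X)ᵀ * H₀ + (-(Xᵀ * H₁) + -(Xᵀ * H₀ * X)) + ((-(Xᵀ * H₁) + -(Xᵀ * H₀ * X)) + (H₂ + H₁ * X + (H₁ * X + H₀ * (X * X)))) = H'₂)
    (q1 : Xbar * 𝔔₀ + 𝔔₁ + 𝔔₀ * X = 𝔔'₁)
    (q2 : Xbar * Xbar * 𝔔₀ + (Xbar * 𝔔₁ + Xbar * 𝔔₀ * X) + ((Xbar * 𝔔₁ + Xbar * 𝔔₀ * X) + (𝔔₂ + 𝔔₁ * X + (𝔔₁ * X + 𝔔₀ * (X * X)))) = 𝔔'₂)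
    -- (T-β-4) intertwining of the transported nested-chart generators with the one-shot chart's generators, unimodular parameter transport
    (j1 : -X * fromCols D₂ D₁ + W₁ = W'₁ + fromCols D₂ D₁ * C₁)
    (j2 : X * X * fromCols D₂ D₁ + (2 : ℝ) • (-X * W₁) + W₂ = W'₂ + (2 : ℝ) • (W'₁ * C₁) + fromCols D₂ D₁ * C₂)
    (uC : secondVar (1 : Matrix (Res (ctr (d + 1) Lc) Lc M' ⊕ Res (ctr (d + 1) Lc) Lc (fine Lc M')) (Res (ctr (d + 1) Lc) Lc M' ⊕ Res (ctr (d + 1) Lc) Lc (fine Lc M')) ℝ) C₁ C₂ = 0)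
    -- the one-shot chart's (UNI)-jet letter (dead big-comb rows `NestedStepLawTransportedDeadRows`, or `TorusOneShotFPExponential.torus_uP_exp`);
    -- dead rows of the nested chart: the coarse comb rows of the average along the nested family (`t1 t2`); the small comb enters by `uLow` below
    (uP' : secondVar (P * fromCols D₂ D₁) (P * W'₁) (P * W'₂) = 0)
    -- the FINE block's Faddeev–Popov 2-jet on the small comb (leaf-06 g21 `NestedFPSplit`: replaces the dead rows `s1 s2`; at the record it is AUTOMATIC
    -- for the exponential generator jets along ANY direction — `NestedFPSplit.torus_uLow_exp`, no comb-support hypothesis on `h`)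
    (uLow : secondVar (τ₁ * (fromCols D₂ D₁).toCols₂) (τ₁ * W₁.toCols₂) (τ₁ * W₂.toCols₂) = 0)
    (t1 : τ₂ * (Q₁₁ * fromCols D₂ D₁ + Q₁₀ * W₁) = 0) (t2 : τ₂ * (Q₁₂ * fromCols D₂ D₁ + (2 : ℝ) • (Q₁₁ * W₁) + Q₁₀ * W₂) = 0)
    -- the parities of the displayed form jets (`H₀ᵀ = H₀` is a theorem: `PeriodisedWardOrderZero.torus_H₀_transpose`)
    (hH₀t : H₀ᵀ = H₀) (hH₁t : H₁ᵀ = -H₁) (hH₂t : H₂ᵀ = H₂)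
    -- the GRADED second-order composite Ward TABLE IDENTITIES (δ-constrained: `𝔎 = H`; the door's one-sided graded shapes, `W₀ := [D₂ | D₁]`); NO transposed rows
    (a0 : H₀ * fromCols D₂ D₁ = 𝔔₀ᵀ * Y₀) (a1 : H₁ * fromCols D₂ D₁ + H₀ * W₁ = -(𝔔₁ᵀ * Y₀) + 𝔔₀ᵀ * Y₁)
    (a2 : H₂ * fromCols D₂ D₁ + (2 : ℝ) • (H₁ * W₁) + H₀ * W₂ = 𝔔₂ᵀ * Y₀ + -((2 : ℝ) • (𝔔₁ᵀ * Y₁)) + 𝔔₀ᵀ * Y₂)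
    -- the insertion-table covariance TABLE IDENTITIES (orders 1, 2; leaf-02's jet shapes) and the coarse covariance identities (order 0 discharged)
    (c1 : Q₁₁ * fromCols D₂ D₁ + Q₁₀ * W₁ = fromCols Db₁ 0) (c2 : Q₁₂ * fromCols D₂ D₁ + (2 : ℝ) • (Q₁₁ * W₁) + Q₁₀ * W₂ = fromCols Db₂ 0)
    (d1 : Q₂₁ * Dbar + Q₂₀ * Db₁ = 0) (d2 : Q₂₂ * Dbar + (2 : ℝ) • (Q₂₁ * Db₁) + Q₂₀ * Db₂ = 0)
    -- block namings and the coarse non-degeneracy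
    {Γ : Matrix (↥(pbox (fine Lc M')) × Fin (d + 1)) (↥(pbox (fine Lc M')) × Fin (d + 1)) ℝ}
    {I : Matrix (↥(pbox (fine Lc M')) × Fin (d + 1)) ((↥(pbox M') × Fin (d + 1)) ⊕ Res (ctr (d + 1) Lc) Lc (fine Lc M')) ℝ}
    {L : Matrix ((↥(pbox M') × Fin (d + 1)) ⊕ Res (ctr (d + 1) Lc) Lc (fine Lc M')) (↥(pbox (fine Lc M')) × Fin (d + 1)) ℝ}
    {S : Matrix ((↥(pbox M') × Fin (d + 1)) ⊕ Res (ctr (d + 1) Lc) Lc (fine Lc M')) ((↥(pbox M') × Fin (d + 1)) ⊕ Res (ctr (d + 1) Lc) Lc (fine Lc M')) ℝ}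
    {B : Matrix ((↥(pbox M') × Fin (d + 1)) ⊕ Res (ctr (d + 1) Lc) Lc (fine Lc M')) (↥(pbox (fine Lc M')) × Fin (d + 1)) ℝ}
    (hΓ : flucCov H₀ (fromRows Q₁₀ τ₁) = Γ) (hI : minOp H₀ (fromRows Q₁₀ τ₁) = I) (hL : minOpL H₀ (fromRows Q₁₀ τ₁) = L) (hS : effForm H₀ (fromRows Q₁₀ τ₁) = S)
    (hB : fromRows Q₁₁ (0 : Matrix (Res (ctr (d + 1) Lc) Lc (fine Lc M')) (↥(pbox (fine Lc M')) × Fin (d + 1)) ℝ) = B)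
    -- (γ-sym) SOCKETS DISPLAYED (leaf-05 g29 INTENT 30: `torus_isUnit_det_kkt_combRows_comb` ∕ `torus_h2_record_comb` at the sym tables)
    (h1 : (kkt H₀ (fromRows Q₁₀ τ₁)).det ≠ 0) (h2 : (kkt S.toBlocks₁₁ (fromRows Q₂₀ τ₂)).det ≠ 0) :
    secondVar (kkt H₀ (fromRows 𝔔₀ P))
        (fromBlocks H'₁ (-(fromRows 𝔔'₁ (0 : Matrix (Res (ctr (d + 1) Lc) Lc M' ⊕ Res (ctr (d + 1) Lc) Lc (fine Lc M')) (↥(pbox (fine Lc M')) × Fin (d + 1)) ℝ))ᵀ)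
          (fromRows 𝔔'₁ (0 : Matrix (Res (ctr (d + 1) Lc) Lc M' ⊕ Res (ctr (d + 1) Lc) Lc (fine Lc M')) (↥(pbox (fine Lc M')) × Fin (d + 1)) ℝ)) 0)
        (kkt H'₂ (fromRows 𝔔'₂ (0 : Matrix (Res (ctr (d + 1) Lc) Lc M' ⊕ Res (ctr (d + 1) Lc) Lc (fine Lc M')) (↥(pbox (fine Lc M')) × Fin (d + 1)) ℝ)))
      = secondVar (kkt H₀ (fromRows Q₁₀ τ₁)) (fromBlocks H₁ (-Bᵀ) B 0)
            (kkt H₂ (fromRows Q₁₂ (0 : Matrix (Res (ctr (d + 1) Lc) Lc (fine Lc M')) (↥(pbox (fine Lc M')) × Fin (d + 1)) ℝ)))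
        + secondVar
            (kkt S.toBlocks₁₁ (fromRows Q₂₀ τ₂))
            (fromBlocks ((L * H₁ - S * B) * I + L * Bᵀ * S).toBlocks₁₁ (-(fromRows Q₂₁ (0 : Matrix (Res (ctr (d + 1) Lc) Lc M') (↥(pbox M') × Fin (d + 1)) ℝ))ᵀ)
              (fromRows Q₂₁ (0 : Matrix (Res (ctr (d + 1) Lc) Lc M') (↥(pbox M') × Fin (d + 1)) ℝ)) 0)
            (kkt (((-((L * H₁ - S * B) * Γ - L * Bᵀ * L) * H₁ + L * H₂
                      - (((L * H₁ - S * B) * I + L * Bᵀ * S) * B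
                          + S * fromRows Q₁₂ (0 : Matrix (Res (ctr (d + 1) Lc) Lc (fine Lc M')) (↥(pbox (fine Lc M')) × Fin (d + 1)) ℝ))) * I
                    + (L * H₁ - S * B) * (-((Γ * H₁ + I * B) * I + Γ * Bᵀ * S)))
                  - ((-((L * H₁ - S * B) * Γ - L * Bᵀ * L) * (-Bᵀ)
                        + L * (fromRows Q₁₂ (0 : Matrix (Res (ctr (d + 1) Lc) Lc (fine Lc M')) (↥(pbox (fine Lc M')) × Fin (d + 1)) ℝ))ᵀ) * S
                      + L * (-Bᵀ) * ((L * H₁ - S * B) * I + L * Bᵀ * S))).toBlocks₁₁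
              (fromRows Q₂₂ (0 : Matrix (Res (ctr (d + 1) Lc) Lc M') (↥(pbox M') × Fin (d + 1)) ℝ))) := by
  -- the torus binders, exactly as in p313662 ∕ p316503
  have hLc1 : 1 ≤ Lc := Nat.one_le_iff_ne_zero.mpr (NeZero.ne Lc)
  have d0 : Q₂₀ * Dbar = 0 := by rw [hQ₂₀, hDbar]; exact torus_sym_cov₀' M' hM' j (j + 1) pμ' mμ'
  have h₁ : Q₁₀ * D₁ = 0 := by rw [hQ₁₀, hD₁]; exact torus_sym_cov₁ M' j
  have h₂ : Q₁₀ * D₂ = Dbar := by rw [hQ₁₀, hD₂, hDbar]; exact torus_sym_cov₂ M' j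
  have hc₁ : |(τ₁ * D₁).det| = 1 := by rw [hτ₁, hD₁]; exact torus_uni₁ M' (ctrOff_mem_box hLc1)
  have hc₂ : |(τ₂ * Dbar).det| = |stepScale d Lc j * ((box (d + 1) Lc).card : ℝ)| ^ Fintype.card (Res (ctr (d + 1) Lc) Lc M') := by
    rw [hτ₂, hDbar]; exact torus_uni₂ M' (ctrOff_mem_box hLc1) hM' j
  have hcP : |(P * fromCols D₂ D₁).det| = 1 := by rw [hP, hD₂, hD₁]; exact torus_uniP M' (ctrOff_mem_box hLc1) (ctrOff_mem_box hLc1) hM'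
  have c0 : Q₁₀ * fromCols D₂ D₁ = fromCols Dbar (0 : Matrix (↥(pbox M') × Fin (d + 1)) (Res (ctr (d + 1) Lc) Lc (fine Lc M')) ℝ) := by
    rw [mul_fromCols, h₂, h₁]
  have b0 := compWard_b0 Q₁₀ Q₂₀ (fromCols D₂ D₁) Dbar c0 d0 h𝔔₀
  have b1 := compWard_b1 Q₁₀ Q₁₁ Q₂₀ Q₂₁ (fromCols D₂ D₁) W₁ Dbar Db₁ c0 c1 d1 h𝔔₀ h𝔔₁
  have b2 := compWard_b2 Q₁₀ Q₁₁ Q₁₂ Q₂₀ Q₂₁ Q₂₂ (fromCols D₂ D₁) W₁ W₂ Dbar Db₁ Db₂ c0 c1 c2 d2 h𝔔₀ h𝔔₁ h𝔔₂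
  have hPW : (P * fromCols D₂ D₁).det ≠ 0 := det_ne_zero_of_abs_det hcP one_ne_zero
  have hTW : (fromRows (τ₂ * Q₁₀) τ₁ * fromCols D₂ D₁).det ≠ 0 :=
    det_nestedSlice_mul_gauge_ne_zero τ₁ τ₂ Q₁₀ D₁ D₂ Dbar h₁ h₂ hc₁ hc₂ one_ne_zero (torus_uni₂_ne_zero M' (ctrOff_mem_box hLc1) j)
  -- the GRADED transported law (exponential currency; colour lift inside) with `G = 0`
  have h := secondVar_oneShot_nestedStepLaw_expTransported_graded_of_uni H₀ H₁ H₂ Q₁₀ Q₁₁ Q₁₂ Q₂₀ Q₂₁ Q₂₂ 0 0 0 τ₁ τ₂ P (fromCols D₂ D₁) W₁ W₂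
    Y₀ Y₁ Y₂ X Xbar W'₁ W'₂ C₁ C₂
    (show H₀ + Q₁₀ᵀ * (0 : Matrix (↥(pbox M') × Fin (d + 1)) (↥(pbox M') × Fin (d + 1)) ℝ) * Q₁₀ = H₀ by simp)
    (show H₁ + (-(Q₁₁ᵀ * (0 : Matrix (↥(pbox M') × Fin (d + 1)) (↥(pbox M') × Fin (d + 1)) ℝ) * Q₁₀)
        + Q₁₀ᵀ * (0 : Matrix (↥(pbox M') × Fin (d + 1)) (↥(pbox M') × Fin (d + 1)) ℝ) * Q₁₀
        + Q₁₀ᵀ * (0 : Matrix (↥(pbox M') × Fin (d + 1)) (↥(pbox M') × Fin (d + 1)) ℝ) * Q₁₁) = H₁ by simp)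
    (show H₂ + ((Q₁₂ᵀ * (0 : Matrix (↥(pbox M') × Fin (d + 1)) (↥(pbox M') × Fin (d + 1)) ℝ) * Q₁₀
          + -(Q₁₁ᵀ * (0 : Matrix (↥(pbox M') × Fin (d + 1)) (↥(pbox M') × Fin (d + 1)) ℝ) * Q₁₀)
          + -(Q₁₁ᵀ * (0 : Matrix (↥(pbox M') × Fin (d + 1)) (↥(pbox M') × Fin (d + 1)) ℝ) * Q₁₁))
        + (-(Q₁₁ᵀ * (0 : Matrix (↥(pbox M') × Fin (d + 1)) (↥(pbox M') × Fin (d + 1)) ℝ) * Q₁₀)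
          + Q₁₀ᵀ * (0 : Matrix (↥(pbox M') × Fin (d + 1)) (↥(pbox M') × Fin (d + 1)) ℝ) * Q₁₀
          + Q₁₀ᵀ * (0 : Matrix (↥(pbox M') × Fin (d + 1)) (↥(pbox M') × Fin (d + 1)) ℝ) * Q₁₁)
        + (-(Q₁₁ᵀ * (0 : Matrix (↥(pbox M') × Fin (d + 1)) (↥(pbox M') × Fin (d + 1)) ℝ) * Q₁₁)
          + Q₁₀ᵀ * (0 : Matrix (↥(pbox M') × Fin (d + 1)) (↥(pbox M') × Fin (d + 1)) ℝ) * Q₁₁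
          + Q₁₀ᵀ * (0 : Matrix (↥(pbox M') × Fin (d + 1)) (↥(pbox M') × Fin (d + 1)) ℝ) * Q₁₂)) = H₂ by simp)
    h𝔔₀ h𝔔₁ h𝔔₂ k1 k2 q1 q2 j1 j2 uC uP' (secondVar_nestedFP_eq_zero_of_t_uLow τ₁ τ₂ Q₁₀ Q₁₁ Q₁₂ (fromCols D₂ D₁) W₁ W₂ Dbar Db₁ Db₂ c0 c1 c2
      (det_ne_zero_of_abs_det hc₂ (torus_uni₂_ne_zero M' (ctrOff_mem_box hLc1) j)) (by rw [Matrix.toCols₂_fromCols]; exact det_ne_zero_of_abs_det hc₁ one_ne_zero)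
      t1 t2 uLow)
    hH₀t hH₁t hH₂t a0 a1 a2 b0 b1 b2 hPW hTW hΓ hI hL hS hB h1 (by rw [add_zero]; exact h2)
  simpa only [add_zero] using h

end Transported

end Summit.QuantumFields.BalabanUV.Beta.FP.NestedStepLawTorusTransportedGradedSymULow

end
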